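import Summits.BirchSwinnertonDyer.BirchSwinnertonDyer.Theorems.AdditiveBranchIMCGordTwoTwistedFieldTwoClassLoose
import Summits.BirchSwinnertonDyer.BirchSwinnertonDyer.Theorems.AdditiveBranchIMCGordTwoRankZeroOffCaseOneFieldSupplyR0Local
import Summits.BirchSwinnertonDyer.Rank1Residual.AdditivePotMult.TwistSupplyJ
import Summits.BirchSwinnertonDyer.BirchSwinnertonDyer.Theorems.AdditiveBranchIMCGordTwoTwistedLooseDefs
import HarnessLib

/-!
# LOOSE VARIANT (LEAD g18, door C «loose SU prime» of LeadReport26 §4 / LeadReport27 §4.2; crux 19357 `three_field_road`): design D2 STAGE 3 (field two)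
# `AdditiveBranchIMCGordTwoTwistedFieldTwoAnyTwo.lean` (LEAD g18, p816400) with the field hypothesis `TameRoadFieldTwistedLoose` (p816632: the twisted
# Wan prime WITHOUT Skinner–Urban's clause) and ONE GENUINE EDIT: the Skinner–Urban prime of the partner `A ≅ E^{(u)}` is no longer the twisted Wan
# prime `q` (where `p ∣ v_q(j)` is now allowed) but ANY multiplicative prime `r ≠ p` of `E` with `p ∤ v_r(Δ_min)` (new hypothesis `hSU`): `r ≠ q`
# (`E` is additive at `q`), so `u` is an `r`-adic square, `A ≅ E` over `ℚ_r`, and `v_r(Δ_min(A)) = −v_r(j(A)) = −v_r(j(E)) = v_r(Δ_min(E))`.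
# Theorems only; `--supports` 19357, helper only; BSD is proved for no curve.
#
# * `exists_fieldTwo_twisted_kronecker_loose`.
-/

/-!
# FieldTwoTwisted, design D2, STAGE 3 (Local′) and the assembled FIELD TWO OF THE TWISTED WAN ROAD
# (crux 19357, line `three_field_road`, stub `stub_twistedWanChainR0`; LEAD g15, LeadReport23 §7–§9)

Theorems only. From Stage 2 (`exists_splitClass_partner_twisted`, p801124): `A ≅ E^{(u)}`, `u = p* D′ d ≡ 1 (mod 4)` square-free,
`u` a square in `ℚ_ℓ` at every bad prime `ℓ ∉ {p, q}` of `E`; `A ≅ Wd^{(d'')}`, `d'' = d_{K''}` a square in `ℚ_q` (`(d''/q) = 1`),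
and `Wd ≅ E^{(d_K)}` is multiplicative NON-split at the twisted Wan prime `q` (the class clause,
`TwistRootNumberTwisted.quadraticTwist_discr_nonsplit_at_of_nonsplitClass`). Hence `A` is multiplicative non-split at `q` with
`ord_q Δ_A = ord_q Δ_{Wd} = −ord_q j(E)`, prime to `p` by `TwistedWanPrime` — the Skinner–Urban prime of `A` is `q` —, the
local Tamagawa numbers of `A` at the bad `ℓ ∉ {p, q}` are those of `E` (`p ∤ ∏ c(E)` on the rank-zero sub-row), and `c_v(A) ≤ 4 < p`
at every other place (`A` not split multiplicative there). Assembled in the conclusion SHAPE of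
`ThreeFieldRoadSupply.exists_fieldTwo_gordTwo` for the pair `(Wd, A)` — the field `K''` is `p`-ramified with the only common prime of
`d_{K''}` and `N_{Wd}` being `p` (so the "ramified bad primes are non-split multiplicative for `A`" clause is vacuous) and `ℓ₀` free.

* `exists_fieldTwo_twisted`.

BSD is proved for no curve. References: [SilvermanAEC2009] VII.5.1, VII.6.1, X.5.4; [FriedbergHoffstein1995] Thm. B; [JetchevSkinnerWan2017] §7.4.1;
[SkinnerUrban2014] Thm. 3.6.4 (the ramification clause `p ∤ ord_ℓ Δ`).
-/

set_option linter.dupNamespace false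
set_option autoImplicit false

noncomputable section

open scoped Classical

open WeierstrassCurve IsDedekindDomain IsDedekindDomain.HeightOneSpectrum NumberField Rat.HeightOneSpectrum
  Literature.NumberTheory.EllipticCurves Literature.NumberTheory.EllipticCurves.ModularForms
  Literature.NumberTheory.EllipticCurves.Rank1Residual Literature.NumberTheory.QuadraticFields
  Summit.BirchSwinnertonDyer.Rank1Residual Summit.BirchSwinnertonDyer.Rank1Residual.Additive
  Summit.BirchSwinnertonDyer.BirchSwinnertonDyer.Theorems

namespace Summit.BirchSwinnertonDyer.BirchSwinnertonDyer.Theorems.TwistedWanRoad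

open NumberTheorySymbols Literature.NumberTheory.EllipticCurves.Castella2018.TamagawaQuadratic
open Summit.BirchSwinnertonDyer.BirchSwinnertonDyer.Theorems.AdditiveKoly.RamifiedHabitat (pStar_emod_four eq_of_prime_dvd_pStar)
open Summit.BirchSwinnertonDyer.BirchSwinnertonDyer.Theorems.ThreeFieldRoadSupply (isSquare_padic_of_fundamental
  not_dvd_tamagawaProduct_of_forall discr_emod_eight_of_two_split)

section FieldTwo

variable (W : WeierstrassCurve ℚ) [W.IsElliptic] [W.IsGloballyMinimal] (p : ℕ) [hp : Fact p.Prime]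
  {q : ℕ} [hq : Fact q.Prime] (K : Type) [Field K] [NumberField K]
  {Wd : WeierstrassCurve ℚ} [Wd.IsElliptic] [Wd.IsGloballyMinimal]

/-- **FIELD TWO ON THE TWISTED WAN ROAD (design D2).** For `(E, p)` on the (G-ord, `e = 2`) cell with `p ≥ 5`, `w(E) = +1`, `ρ̄_{E,p}`
onto, `p ∤ ∏ c(E)`, odd additive primes of twist type, `2` of twist type if additive, a LOOSE twisted road field `K` at
the twisted Wan prime `q` and a globally minimal `Wd ≅ E^{(d_K)}`: a `p`-ramified imaginary quadratic `K''` for `(Wd, A)` with a free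
ramified prime, and a globally minimal `A ≅ Wd^{(d_{K''})}` of analytic rank `0`, good ordinary at `p`, `ρ̄_{A,p}` onto, multiplicative
at the Skinner–Urban prime `r` of `E` (`hSU`) with `p ∤ ord_r(Δ_A)`, and `p ∤ ∏ c(A)` — the conclusion shape of `ThreeFieldRoadSupply.exists_fieldTwo_gordTwo`.
[cite: FriedbergHoffstein1995, Thm. B (1), as applied in JetchevSkinnerWan2017 §7.4.1] [cite: SilvermanAEC2009, X.5 Cor. 5.4, VII.5.1 and Thm VII.6.1] -/
theorem exists_fieldTwo_twisted_kronecker_loose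
    (hFH : friedbergHoffstein_exists_heegnerField_splitDivisors_twist_ne_zero)
    (hmod : exists_isNewformOf) (hL : hasEntireLFunction_rat)
    (hp5 : 5 ≤ p) (hw : W.rootNumber = 1) (hcell : N10.CellGordTwo W p) (hsurj : Surj W p)
    (htam : ¬ p ∣ W.tamagawaProduct)
    (htt : ∀ r : Nat.Primes, (r : ℕ) ≠ 2 → W.HasAdditiveReductionAt ((primesEquiv (R := ℤ)).symm r) →
      ¬ (W.quadraticTwist (((-1 : ℤ) ^ ((r : ℕ) / 2) * r : ℤ) : ℚ)).HasAdditiveReductionAt ((primesEquiv (R := ℤ)).symm r))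
    (h2tt : ∀ r : Nat.Primes, (r : ℕ) = 2 → W.HasAdditiveReductionAt ((primesEquiv (R := ℤ)).symm r) →
      ∃ t : ℤ, (t = -1 ∨ t = 2 ∨ t = -2) ∧ ¬ (W.quadraticTwist (t : ℚ)).HasAdditiveReductionAt ((primesEquiv (R := ℤ)).symm r))
    (hK : TameRoadFieldTwistedLoose W p q K)
    (hSU : ¬ (p : ℤ) ∣ padicValRat q W.j ∨
      ∃ (r : ℕ) (_ : Fact r.Prime), r ≠ p ∧ W.HasMultiplicativeReductionAtPrime r ∧ ¬ p ∣ padicValInt r W.minimalDiscriminantInt)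
    (Cd : VariableChange ℚ) (hWd : Cd • W.quadraticTwist (NumberField.discr K : ℚ) = Wd) :
    ∃ (K'' : Type) (_ : Field K'') (_ : NumberField K'')
      (A : WeierstrassCurve ℚ) (_ : A.IsElliptic) (_ : A.IsGloballyMinimal),
      (IsImaginaryQuadratic K'' ∧ (p : ℤ) ∣ NumberField.discr K'' ∧
        (∀ ℓ : ℕ, ℓ.Prime → ℓ ∣ Wd.conductorNorm ℤ → ¬ (ℓ : ℤ) ∣ NumberField.discr K'' →
          SatisfiesHeegnerHypothesis ℓ K'') ∧
        (∀ ℓ : ℕ, (hℓ : ℓ.Prime) → ℓ ∣ Wd.conductorNorm ℤ → (ℓ : ℤ) ∣ NumberField.discr K'' → ℓ ≠ p →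
          (haveI : Fact ℓ.Prime := ⟨hℓ⟩;
            A.HasMultiplicativeReductionAtPrime ℓ ∧ ¬ A.HasSplitMultiplicativeReductionAtPrime ℓ))) ∧
      (∃ ℓ : ℕ, ℓ.Prime ∧ (ℓ : ℤ) ∣ NumberField.discr K'' ∧ ℓ ≠ p ∧ ¬ ℓ ∣ Wd.conductorNorm ℤ) ∧
      (∃ C : VariableChange ℚ, C • Wd.quadraticTwist (NumberField.discr K'' : ℚ) = A) ∧
      A.analyticRank = 0 ∧ GoodOrd A p ∧ Surj A p ∧
      (∃ ℓ : ℕ, ∃ _ : Fact ℓ.Prime, ℓ ≠ p ∧ A.HasMultiplicativeReductionAtPrime ℓ ∧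
        ¬ p ∣ padicValInt ℓ A.minimalDiscriminantInt) ∧
      ¬ p ∣ A.tamagawaProduct := by
  have hp2 : p ≠ 2 := by omega
  have hK' := hK
  obtain ⟨hKiq, -, htw, hcls, -, -, -⟩ := hK'
  obtain ⟨hqp, hq2, haddq, hmultq⟩ := htw
  obtain ⟨ℓ₀, D', d, K'', iF'', iN'', A, iA, iAm, hℓ₀, hℓ₀p, hℓ₀q, hℓ₀2, hℓ₀NWd, hℓ₀NW, hdisc, hK'', hsplit'', hram'',
      hJDq, ⟨CD, hCD⟩, hD', ⟨Cu, hCu⟩, hu4, husq, hJu, hrA, hgoA, hsurjA⟩ :=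
    exists_splitClass_partner_twisted_kronecker_loose W p K hFH hmod hL hp5 hw hcell hsurj htt h2tt hK Cd hWd
  obtain ⟨u, hu⟩ : ∃ u : ℤ, u = ((-1 : ℤ) ^ (p / 2) * p) * D' * d := ⟨_, rfl⟩
  rw [← hu] at hCu hu4 husq hJu
  -- `u ≠ 0, 1`, `p ∣ u`
  have hpu : (p : ℤ) ∣ u := by
    rw [hu]
    exact Dvd.dvd.mul_right (Dvd.dvd.mul_right (Dvd.intro_left _ rfl) _) _
  have hu1 : u ≠ 1 := fun h ↦ by
    rw [h] at hpu
    exact hp.out.ne_one (by exact_mod_cast Int.eq_one_of_dvd_one (by norm_num) hpu)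
  have hu0 : u ≠ 0 := fun h ↦ by rw [h] at hu4; norm_num at hu4
  have huq : ((u : ℤ) : ℚ) ≠ 0 := by exact_mod_cast hu0
  -- squares at the bad primes `∉ {p, q}` of `E`
  have hsq : ∀ ℓ : ℕ, (hℓ : ℓ.Prime) → ℓ ∣ W.conductorNorm ℤ → ℓ ≠ p → ℓ ≠ q →
      (haveI : Fact ℓ.Prime := ⟨hℓ⟩; IsSquare (((u : ℤ) : ℚ) : ℚ_[ℓ])) := by
    intro ℓ hℓ hℓN hℓp hℓq
    haveI : Fact ℓ.Prime := ⟨hℓ⟩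
    exact isSquare_padic_of_fundamental hu4 husq hu1 (hJu ℓ hℓ hℓN hℓp hℓq)
  -- §1 at the twisted Wan prime `q`: `A ≅ Wd^{(d'')}` with `d''` a square in `ℚ_q`, `Wd` non-split multiplicative
  obtain ⟨D, hDdef⟩ : ∃ D : ℤ, D = NumberField.discr K'' := ⟨_, rfl⟩
  have hD4 : D % 4 = 1 := by
    rw [hDdef, hdisc, Int.mul_emod, show (((-1 : ℤ) ^ (p / 2) * p) * ((-1 : ℤ) ^ (ℓ₀ / 2) * ℓ₀)) % 4 = 1 by
      rw [Int.mul_emod, pStar_emod_four (p := p) hp2, (haveI := Fact.mk hℓ₀; pStar_emod_four (p := ℓ₀) hℓ₀2)]; decide]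
    have hd8 : d % 4 = 1 := by
      have h1 : u % 4 = 1 := hu4
      -- `u = p* D' d` with `p* D' ≡ ?`; easier: `d` is the FH discriminant, `u ≡ 1`, and `D' ≡ 1 (4)`
      have hD'4 : D' % 4 = 1 := by
        rw [hD', Int.mul_emod, (discr_emod_eight_of_two_split K hKiq ?_).2.1,
          (haveI := Fact.mk hℓ₀; pStar_emod_four (p := ℓ₀) hℓ₀2)]
        · decide
        · obtain ⟨-, -, -, -, hsplit, h2split, -⟩ := hK
          by_cases h2N : 2 ∣ W.conductorNorm ℤ
          · exact hsplit 2 Nat.prime_two h2N (Ne.symm hq2)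
          · exact h2split h2N
      have hps4 : ((-1 : ℤ) ^ (p / 2) * p) % 4 = 1 := pStar_emod_four (p := p) hp2
      have e : u % 4 = ((((-1 : ℤ) ^ (p / 2) * p) * D') % 4 * (d % 4)) % 4 := by rw [hu, Int.mul_emod]
      rw [show (((-1 : ℤ) ^ (p / 2) * p) * D') % 4 = 1 by rw [Int.mul_emod, hps4, hD'4]; decide, one_mul,
        Int.emod_emod_of_dvd _ (dvd_refl (4 : ℤ))] at e
      rw [← e]; exact h1
    rw [hd8]; decide
  have hDsq : Squarefree D := by
    rw [hDdef]
    rcases Quadratic.isFundamentalDiscriminant_discr (K := K'') hK''.1 with ⟨-, hsq', -⟩ | ⟨h4, -, -⟩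
    · exact hsq'
    · exfalso; rw [← hDdef] at h4; omega
  have hD1 : D ≠ 1 := fun h ↦ by
    have : (p : ℤ) ∣ D := by
      rw [hDdef, hdisc]; exact Dvd.dvd.mul_right (Dvd.dvd.mul_right (Dvd.intro_left _ rfl) _) _
    rw [h] at this
    exact hp.out.ne_one (by exact_mod_cast Int.eq_one_of_dvd_one (by norm_num) this)
  have hD0 : D ≠ 0 := fun h ↦ by rw [h] at hD4; norm_num at hD4
  have hDq : ((D : ℤ) : ℚ) ≠ 0 := by exact_mod_cast hD0
  have hsqD : IsSquare (((D : ℤ) : ℚ) : ℚ_[q]) :=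
    isSquare_padic_of_fundamental hD4 hDsq hD1 ⟨fun h ↦ absurd h hq2, fun _ ↦ by rw [hDdef]; exact hJDq⟩
  -- `Wd` is multiplicative and non-split at `q` (the class clause)
  have hclass : legendreSym q (NumberField.discr K / ((-1 : ℤ) ^ (q / 2) * q)) =
      (if (W.quadraticTwist (((-1 : ℤ) ^ (q / 2) * q : ℤ) : ℚ)).HasSplitMultiplicativeReductionAtPrime q
        then -1 else 1) := by
    have h := hcls.2; rw [primeStar_eq] at h; exact h
  have hmultq' : (W.quadraticTwist (((-1 : ℤ) ^ (q / 2) * q : ℤ) : ℚ)).HasMultiplicativeReductionAtPrime q := by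
    have h := hmultq; rw [primeStar_eq] at h; exact h
  obtain ⟨hWdmult, hWdns⟩ := TwistRootNumberTwisted.quadraticTwist_discr_nonsplit_at_of_nonsplitClass W hq2 hmultq'
    K hKiq hcls.1 hclass Wd ⟨Cd, hWd⟩
  have hCD' : CD • Wd.quadraticTwist ((D : ℤ) : ℚ) = A := by rw [hDdef]; exact hCD
  have hmultA : A.HasMultiplicativeReductionAtPrime q :=
    (X11b.mult_iff_of_twist Wd hDq hsqD A hCD').mpr hWdmult
  have hnsA : ¬ A.HasSplitMultiplicativeReductionAtPrime q := by
    haveI := Wd.isElliptic_quadraticTwist hDq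
    rw [← hCD', hasSplitMultiplicativeReductionAtPrime_smul_iff,
      hasSplitMultiplicativeReductionAtPrime_quadraticTwist_iff Wd hDq (by simpa using hsqD)]
    exact hWdns
  -- `j(A) = j(E)`
  have hjA : A.j = W.j := by
    rw [AdditivePotMult.j_of_model_twist huq ⟨Cu, hCu⟩]
  -- the Skinner–Urban prime of `A`: EITHER `q` itself when `p ∤ v_q(j)` (the strict case, as in the any-two file), OR the multiplicative prime
  -- `r` of `E` with `p ∤ v_r(Δ_min)` (`r ≠ q`: `E` is additive at `q`)
  have hSUA : ∃ (ℓ : ℕ) (_ : Fact ℓ.Prime), ℓ ≠ p ∧ A.HasMultiplicativeReductionAtPrime ℓ ∧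
      ¬ p ∣ padicValInt ℓ A.minimalDiscriminantInt := by
    rcases hSU with hjq | ⟨r, hrF, hrp, hmultr, hΔr⟩
    · refine ⟨q, hq, hqp, hmultA, ?_⟩
      rw [AdditivePotMult.dvd_padicValInt_minimalDiscriminantInt_iff_of_mult A q hmultA p, hjA]
      exact hjq
    · refine ⟨r, hrF, hrp, ?_⟩
      have hrq : r ≠ q := by
        intro hrq'
        have key : ∀ (n : ℕ) (i₁ : Fact n.Prime) (i₂ : Fact q.Prime), n = q →
            @HasMultiplicativeReductionAtPrime W n i₁ → @HasMultiplicativeReductionAtPrime W q i₂ := by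
          rintro n i₁ i₂ rfl h; exact h
        have hm : W.HasMultiplicativeReductionAt ((primesEquiv (R := ℤ)).symm ⟨q, hq.out⟩) :=
          (W.hasMultiplicativeReductionAtPrime_iff_hasMultiplicativeReductionAt_holds ⟨q, hq.out⟩).mp (key _ _ _ hrq' hmultr)
        exact hm.not_hasAdditiveReductionAt haddq
      have hrN : r ∣ W.conductorNorm ℤ :=
        (hrF.out.dvd_iff_one_le_factorization (W.conductorNorm_pos_holds).ne').mpr
          (by rw [W.factorization_conductorNorm_eq_one_of_hasMultiplicativeReductionAtPrime r hmultr])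
      have hmultAr : A.HasMultiplicativeReductionAtPrime r :=
        (X11b.mult_iff_of_twist W huq (hsq r hrF.out hrN hrp hrq) A hCu).mpr hmultr
      refine ⟨hmultAr, ?_⟩
      rw [AdditivePotMult.dvd_padicValInt_minimalDiscriminantInt_iff_of_mult A r hmultAr p, hjA,
        ← AdditivePotMult.dvd_padicValInt_minimalDiscriminantInt_iff_of_mult W r hmultr p]
      exact hΔr
  -- §2 the Tamagawa product of `A`
  have htamA : ¬ p ∣ A.tamagawaProduct := by
    refine not_dvd_tamagawaProduct_of_forall A p fun v ↦ ?_
    set ℓ : ℕ := (primesEquiv v : ℕ) with hℓdef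
    haveI hℓF : Fact ℓ.Prime := ⟨(primesEquiv v).2⟩
    by_cases hcase : ℓ ∣ W.conductorNorm ℤ ∧ ℓ ≠ p ∧ ℓ ≠ q
    · -- `A ⊗ ℚ_ℓ ≅ E ⊗ ℚ_ℓ`: same local Tamagawa number, and `p ∤ c_ℓ(E)`
      rw [localTamagawaNumber_eq_of_twist_of_isSquare W v (ℓ := ℓ) rfl huq
        (hsq ℓ hℓF.out hcase.1 hcase.2.1 hcase.2.2) A hCu]
      intro hdvd
      apply htam
      set cW : HeightOneSpectrum (𝓞 ℚ) → ℕ := fun v =>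
        (W.baseChange (v.adicCompletion ℚ)).localTamagawaNumber (v.adicCompletionIntegers ℚ) with hcW
      have hfin : (Function.mulSupport cW).Finite := W.mulSupport_localTamagawaNumber_finite_holds
      rw [show W.tamagawaProduct = ∏ᶠ v, cW v from rfl,
        finprod_eq_prod_of_mulSupport_subset cW (s := hfin.toFinset) (by simp)]
      by_cases hv1 : cW v = 1
      · exfalso
        have : p ∣ 1 := by rw [← hv1]; exact hdvd
        exact hp.out.ne_one (Nat.dvd_one.mp this)
      · exact hdvd.trans (Finset.dvd_prod_of_mem cW (hfin.mem_toFinset.mpr hv1))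
    · -- `A` is not split multiplicative at `v`: `c_v(A) ≤ 4 < p`
      obtain ⟨h1, -, h4⟩ := kodairaNeron_localTamagawaNumber A v
      have hns : ¬ A.HasSplitMultiplicativeReductionAt v := by
        by_cases hℓq : ℓ = q
        · -- at `q`: non-split (§1)
          intro hsplitv
          have hsp := (A.hasSplitMultiplicativeReductionAtPrime_iff_hasSplitMultiplicativeReductionAt v).mpr hsplitv
          have key : ∀ (n : ℕ) (i₁ : Fact n.Prime) (i₂ : Fact q.Prime), n = q →
              @HasSplitMultiplicativeReductionAtPrime A n i₁ → @HasSplitMultiplicativeReductionAtPrime A q i₂ := by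
            rintro n i₁ i₂ rfl h; exact h
          exact hnsA (key _ _ _ hℓq hsp)
        intro hsplitv
        have hmult := hsplitv.hasMultiplicativeReductionAt
        have hlt := one_lt_valuation_j v A hmult
        have hle : v.valuation ℚ A.j ≤ 1 := by
          by_cases hℓp : ℓ = p
          · -- `A` is good at `p`
            refine Additive.valuation_j_le_one_of_hasGoodReductionAt A v ?_
            refine (hasGoodReductionAtPrime_iff_hasGoodReductionAt_ringOfIntegers v A).mp ?_
            have hg : A.HasGoodReductionAtPrime p := hgoA.1
            have key : ∀ (n : ℕ) (i₁ : Fact n.Prime) (i₂ : Fact p.Prime), n = p →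
                @HasGoodReductionAtPrime A p i₂ → @HasGoodReductionAtPrime A n i₁ := by
              rintro n i₁ i₂ rfl h; exact h
            exact key _ _ _ hℓp hg
          · -- `E` is good at `ℓ ∤ N_E`, and `j(A) = j(E)`
            have hℓN : ¬ ℓ ∣ W.conductorNorm ℤ := fun h ↦ hcase ⟨h, hℓp, hℓq⟩
            have hgood : W.HasGoodReductionAtPrime ℓ :=
              not_not.mp (mt (W.dvd_conductorNorm_iff_not_hasGoodReductionAtPrime ℓ).mpr hℓN)
            rw [hjA]
            exact Additive.valuation_j_le_one_of_hasGoodReductionAt W v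
              ((hasGoodReductionAtPrime_iff_hasGoodReductionAt_ringOfIntegers v W).mp hgood)
        exact (not_lt.mpr hle) hlt
      have hc4 := h4 hns
      intro hdvd
      have := Nat.le_of_dvd (by omega) hdvd
      omega
  refine ⟨K'', iF'', iN'', A, iA, iAm, ⟨hK'', ?_, ?_, ?_⟩, ⟨ℓ₀, hℓ₀, ?_, hℓ₀p, hℓ₀NWd⟩, ⟨CD, hCD⟩, hrA,
    hgoA, hsurjA, hSUA, htamA⟩
  · -- `p ∣ d_{K''}`
    rw [hdisc]
    exact Dvd.dvd.mul_right (Dvd.dvd.mul_right (Dvd.intro_left _ rfl) _) _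
  · -- every prime of `N_{Wd}` off `d_{K''}` satisfies the Heegner hypothesis in `K''`
    intro ℓ hℓ hℓN hℓD
    have hℓp : ℓ ≠ p := by
      rintro rfl
      apply hℓD
      rw [hdisc]
      exact Dvd.dvd.mul_right (Dvd.dvd.mul_right (Dvd.intro_left _ rfl) _) _
    exact hsplit'' ℓ hℓ (hℓN.mul_left _) hℓp
  · -- no common prime of `N_{Wd}` and `d_{K''}` other than `p`
    intro ℓ hℓ hℓN hℓD hℓp
    exact (hℓp (hram'' ℓ hℓ hℓD (hℓN.mul_left _))).elim
  · -- the free prime `ℓ₀ ∣ d_{K''}`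
    rw [hdisc]
    exact Dvd.dvd.mul_right (Dvd.dvd.mul_left (Dvd.intro_left _ rfl) _) _

end FieldTwo

end Summit.BirchSwinnertonDyer.BirchSwinnertonDyer.Theorems.TwistedWanRoad

end
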